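import Summits.Ventures.HodgeRepro0.P5BlockCensus

/-!
# P5BlockCensusPairs — the pairs-only method for NONDEGENERATE cyclotomic CM types, generic and kernel-checkable

p5 (g21), 2026-08-29.  Supporting artefact (R-5): finite combinatorics only; nothing here is an algebraicity statement.
Companion of `P5BlockCensus.lean`.  For a nondegenerate type every balanced set is a union of conjugate pairs; the
certificate is a table of PINNING functionals (`ptab`: for each pair representative `a` an integer functional with
`Σ_k q(k) ε(k a) = d` and `0` at the other representatives), which force `n_S(a) = 0` on a balanced `S`
(`balanced_iff_pairs`).  The facts needed are the decidable proposition `PFacts D`.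
-/

namespace HodgeRepro0.P5BlockCensus

variable (D : Data)

/-- THE FACTS of the pairs-only method (a nondegenerate type): the core facts; the pinning table (`d` at its
representative, `0` at the others); `d ≠ 0`; every representative pinned. -/
abbrev PFacts : Prop :=
  Core D ∧
  (∀ e ∈ D.ptab, ∀ t ∈ R D, wL D e.2 t = if t = e.1 then D.d else 0) ∧
  D.d ≠ 0 ∧
  (∀ t ∈ R D, ∃ e ∈ D.ptab, e.1 = t) ∧
  (∀ e ∈ D.ptab, e.1 ∈ R D)

variable {D}

section
variable (hP : PFacts D)
include hP

/-- The core facts. -/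
theorem p_core : Core D := hP.1
/-- The pinning table: `w_q(t) = d` at `a`, `0` at the other representatives, for each entry `(a, q)`. -/
theorem p_w_table : ∀ e ∈ D.ptab, ∀ t ∈ R D, wL D e.2 t = if t = e.1 then D.d else 0 := hP.2.1
/-- The pinning value is non-zero. -/
theorem p_d : D.d ≠ 0 := hP.2.2.1
/-- Every representative is pinned by some entry. -/
theorem p_pinned : ∀ t ∈ R D, ∃ e ∈ D.ptab, e.1 = t := hP.2.2.2.1
/-- Each entry's `a` is a representative. -/
theorem p_entry : ∀ e ∈ D.ptab, e.1 ∈ R D := hP.2.2.2.2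
end

/-! ### The pairs-only method (nondegenerate types) -/

section
variable (hP : PFacts D)
include hP

/-- For a pinning entry `(a, q)`: `Σ_{t ∈ R} n_S(t) w_q(t) = d · n_S(a)`. -/
theorem sum_nw_pin (S : Finset ℕ) (e : ℕ × List (ℕ × ℤ)) (he : e ∈ D.ptab) :
    ∑ t ∈ Rf D, nS D S t * w D e.2 t = D.d * nS D S e.1 := by
  have ha' : e.1 ∈ Rf D := List.mem_toFinset.mpr (p_entry hP e he)
  calc ∑ t ∈ Rf D, nS D S t * w D e.2 t
      = ∑ t ∈ Rf D, (if t = e.1 then D.d * nS D S t else 0) := by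
        apply Finset.sum_congr rfl
        intro t ht
        rw [w_eq_wL (p_core hP), p_w_table hP e he t (List.mem_toFinset.mp ht)]
        by_cases h1 : t = e.1
        · subst h1; simp only [ite_true]; ring
        · simp only [if_neg h1, mul_zero]
    _ = D.d * nS D S e.1 := by
        rw [Finset.sum_ite_eq']
        simp [ha']

/-- A balanced `S ⊆ U` of a nondegenerate type has `n_S = 0` on every representative. -/
theorem n_zero_of_balanced (S : Finset ℕ) (hS : S ⊆ U D) (hb : Balanced D S) : ∀ t ∈ R D, nS D S t = 0 := by
  intro t ht
  obtain ⟨e, he, rfl⟩ := p_pinned hP t ht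
  have h0 : ∑ k ∈ U D, qval e.2 k * sig D S k = 0 := by
    apply Finset.sum_eq_zero
    intro k hk
    rw [(balanced_iff_sig S).mp hb k (List.mem_toFinset.mp hk), mul_zero]
  rw [dot_eq (p_core hP) S hS, sum_nw_pin hP S e he] at h0
  rcases mul_eq_zero.mp h0 with h | h
  · exact absurd h (p_d hP)
  · exact h

/-- THE PAIRS-ONLY THEOREM: for a nondegenerate type, `S ⊆ U` is balanced iff it is a union of conjugate pairs
(`t ∈ S ↔ −t ∈ S` for every representative `t`). -/
theorem balanced_iff_pairs (S : Finset ℕ) (hS : S ⊆ U D) :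
    Balanced D S ↔ ∀ t ∈ R D, (t ∈ S ↔ conj D t ∈ S) := by
  constructor
  · intro hb t ht
    have := n_zero_of_balanced hP S hS hb t ht
    unfold nS at this
    by_cases h1 : t ∈ S <;> by_cases h2 : conj D t ∈ S <;> simp_all
  · intro h
    rw [balanced_iff_sig]
    intro k hk
    rw [sig_eq_sum_R (p_core hP) S hS k hk]
    apply Finset.sum_eq_zero
    intro t ht
    have hiff := h t (List.mem_toFinset.mp ht)
    have : nS D S t = 0 := by
      unfold nS
      by_cases h1 : t ∈ S <;> by_cases h2 : conj D t ∈ S <;> simp_all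
    rw [this, zero_mul]

end

end HodgeRepro0.P5BlockCensus
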